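import Mathlib
import HarnessLib
import Summits.AtomisticToContinuum.Crystallization.Theorems.BrittleRungDescentSoftLayerPropagationCaseFCore
import Summits.AtomisticToContinuum.Crystallization.Theorems.BrittleRungDescentSoftLayerPropagationCaseFLattice
import Summits.AtomisticToContinuum.Crystallization.Theorems.PricedLinkCensusSoftLayerPropagationStubBallPropagationFrames

/-!
# Local layer propagation, FCC case: the certified ball, the two outer steps, assembly

Route `BrittleRungDescent`, support item `SoftLayerPropagation` (stmt-AtomisticToContinuum-9210),
helper file (η = 0; setting and notation of `…CaseFCore.lean`; the lattice facts of
`…CaseFLattice.lean` and the frame lemma `exists_frame_of_fcc_centre` of `PricedLinkCensus…Frames.lean`).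

* `chain_certified` — **every centre within `ρ` of `c` is a certified lattice point**
  (`x ∈ AddSubgroup.closure F`, shell exactly `F`) for every `ρ ≤ D`, `ρ < Rp`: descend to the
  core along closer neighbours (`exists_mem_kissingShell_norm_add_sub_sq_le`: the squared distance
  to `c` drops by `> 1` outside the `19/10`-ball), then climb back with the FCC step
  (`kissingShell_add_eq_of_fcc`; the shells are FCC inside the `D`-ball).
* `mem_closure_of_norm_sub_le` — **every centre within `Rc` of `c` is a lattice point**, for radii
  `Rc, ν, ν₂` with `r² − 2√2 r + 4 ≤ ν²` on `[0, Rc]`, the same from `ν` to `ν₂`, `ν₂ ≤ D`,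
  `ν < Rp`, `Rc < Rp` and the margin `Rc < D + 𝗁`: two closer-neighbour steps `x → x₁ → x₂` reach the
  certified ball; `x₁` is FCC (one FCC step) or HCP, and then `x − x₁` lies in `F` or in the far
  triple of `x₁` — a full layer beyond a mirror plane at distance `> D` from `c`, farther than `Rc`.
* `caseF_ball` — **the FCC case of the finite-ball statement** in the packing's own coordinates:
  `V` a packing of unit balls with Hales's separation, `R ≥ 4`, FCC/HCP shells at every centre
  within `2R − 2` of `u`, no HCP mirror plane within `R − 3/2` of `u`, a centre within `√2` of `u`
  ⇒ the centres within `R` of `u` lie in a moved Barlow stacking (frame at the deep centre,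
  `mem_closure_of_norm_sub_le` with `ν = R − 1`, `ν₂ = √((R−1)² − 2√2 (R−1) + 4)`).

All statements are elementary ([folklore]).
-/

noncomputable section

namespace Summit.AtomisticToContinuum.Crystallization.Theorems

open Literature.Geometry.DiscreteGeometry Literature.MathematicalPhysics.StatisticalMechanics
open RealInnerProductSpace

/-- The closer-neighbour bound is largest at the ends of `[0, Rc]`: if `4 ≤ ν²` and
`Rc² − 2√2 Rc + 4 ≤ ν²` then `r² − 2√2 r + 4 ≤ ν²` for `0 ≤ r ≤ Rc`. [folklore] -/
theorem step_bound_le {r Rc ν : ℝ} (h4 : 4 ≤ ν ^ 2) (hν : Rc ^ 2 - 2 * Real.sqrt 2 * Rc + 4 ≤ ν ^ 2)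
    (hr0 : 0 ≤ r) (hr : r ≤ Rc) : r ^ 2 - 2 * Real.sqrt 2 * r + 4 ≤ ν ^ 2 := by
  have h2 : Real.sqrt 2 ^ 2 = 2 := Real.sq_sqrt (by norm_num)
  have hs : 0 ≤ Real.sqrt 2 := Real.sqrt_nonneg 2
  rcases le_total r (Real.sqrt 2) with h | h
  · nlinarith [mul_nonneg hr0 (sub_nonneg.2 h)]
  · nlinarith [mul_nonneg (sub_nonneg.2 h) (sub_nonneg.2 hr)]

section Chain

variable {V : Set (EuclideanSpace ℝ (Fin 3))} {F : Set (EuclideanSpace ℝ (Fin 3))}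
  {c : EuclideanSpace ℝ (Fin 3)} {Rp D : ℝ}

/-- **The certified ball.**  In the setting of `…CaseFCore.lean`, for every `ρ ≤ D` with `ρ < Rp`,
every centre `x` within `ρ` of `c` lies in the lattice `AddSubgroup.closure F` and has shell
exactly `F`. [folklore] -/
theorem chain_certified
    (hsep : ∀ x ∈ V, ∀ y ∈ V, x = y ∨ dist x y = 2 ∨ 2 * hales_h0 ≤ dist x y)
    (hF : IsArrangedIn F fccKissingPattern) (h0V : (0 : EuclideanSpace ℝ (Fin 3)) ∈ V)
    (h0 : kissingShell V 0 = F) (hc : ‖c‖ ≤ Real.sqrt 2) (hRp : 4 ≤ Rp) (hD : 19 / 10 ≤ D)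
    (hpat : ∀ y ∈ V, ‖y - c‖ < Rp →
      IsArrangedIn (kissingShell V y) fccKissingPattern ∨ IsArrangedIn (kissingShell V y) hcpKissingPattern)
    (hnohcp : ∀ y ∈ V, ‖y - c‖ < Rp → ∀ B : EuclideanSpace ℝ (Fin 3) →ₗᵢ[ℝ] EuclideanSpace ℝ (Fin 3),
      kissingShell V y = Set.range (fun i => B (hcpRef i)) →
      D < |⟪c - y, B ((Real.sqrt 3)⁻¹ • intVec ![1, 1, 1])⟫|)
    {ρ : ℝ} (hρD : ρ ≤ D) (hρR : ρ < Rp) :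
    ∀ x ∈ V, ‖x - c‖ ≤ ρ →
      x ∈ (AddSubgroup.closure F : AddSubgroup (EuclideanSpace ℝ (Fin 3))) ∧ kissingShell V x = F := by
  have hs2 : (1.41 : ℝ) < Real.sqrt 2 := by
    rw [show (1.41 : ℝ) = Real.sqrt (1.41 ^ 2) by rw [Real.sqrt_sq (by norm_num)]]
    exact Real.sqrt_lt_sqrt (by norm_num) (by norm_num)
  -- strong induction on `⌈‖x − c‖²⌉`
  suffices key : ∀ n : ℕ, ∀ x ∈ V, ‖x - c‖ ≤ ρ → ‖x - c‖ ^ 2 < n →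
      x ∈ (AddSubgroup.closure F : AddSubgroup (EuclideanSpace ℝ (Fin 3))) ∧ kissingShell V x = F by
    intro x hxV hxρ
    obtain ⟨n, hn⟩ := exists_nat_gt (‖x - c‖ ^ 2)
    exact key n x hxV hxρ hn
  intro n
  induction n using Nat.strong_induction_on with
  | _ n IH =>
    intro x hxV hxρ hxn
    by_cases hcore : ‖x - c‖ ≤ 19 / 10
    · exact core_certified hsep hF h0V h0 hc hRp hD hpat hnohcp hxV hcore
    · push Not at hcore
      have hxR : ‖x - c‖ < Rp := lt_of_le_of_lt hxρ hρR
      obtain ⟨p, hp, hle⟩ := exists_mem_kissingShell_norm_add_sub_sq_le (hpat x hxV hxR) c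
      have hx'V : x + p ∈ V := hp.1
      have hp2 : ‖p‖ = 2 := hp.2
      have hdrop : ‖x + p - c‖ ^ 2 < ‖x - c‖ ^ 2 - 1 := by nlinarith
      -- the induction hypothesis applies to `x + p`
      have hn1 : 1 ≤ n := by
        by_contra h
        push Not at h
        interval_cases n
        simp at hxn
        nlinarith [norm_nonneg (x - c)]
      have hx'n : ‖x + p - c‖ ^ 2 < ((n - 1 : ℕ) : ℝ) := by
        rw [Nat.cast_sub hn1]; push_cast; linarith
      have hx'ρ : ‖x + p - c‖ ≤ ρ := by
        have h1 : ‖x + p - c‖ ^ 2 ≤ ρ ^ 2 := by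
          have : ‖x - c‖ ^ 2 ≤ ρ ^ 2 := pow_le_pow_left₀ (norm_nonneg _) hxρ 2
          linarith
        exact (abs_le_of_sq_le_sq' h1 (le_trans (norm_nonneg _) hxρ)).2
      obtain ⟨hx'L, hx'S⟩ := IH (n - 1) (by omega) (x + p) hx'V hx'ρ hx'n
      -- climb back: `−p ∈ F`, `x = (x + p) + (−p)`
      have hnegp : -p ∈ kissingShell V (x + p) := ⟨by simpa using hxV, by rw [norm_neg, hp2]⟩
      have hpF : -p ∈ F := hx'S ▸ hnegp
      have hxe : x = (x + p) + -p := by abel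
      refine ⟨?_, ?_⟩
      · rw [hxe]; exact AddSubgroup.add_mem _ hx'L (AddSubgroup.subset_closure hpF)
      · have hxfcc : IsArrangedIn (kissingShell V x) fccKissingPattern :=
          isArrangedIn_fcc_of_norm_sub_le hpat hnohcp hxV hxR (hxρ.trans hρD)
        have := kissingShell_add_eq_of_fcc hF hx'V hx'S hpF (by rw [← hxe]; exact hxfcc)
        rwa [← hxe] at this

/-- **The outer two steps.**  In the setting of `…CaseFCore.lean`, let `Rc, ν, ν₂` satisfy
`4 ≤ ν²`, `Rc² − 2√2 Rc + 4 ≤ ν²`, `4 ≤ ν₂²`, `ν² − 2√2 ν + 4 ≤ ν₂²`, `0 ≤ ν`, `0 ≤ ν₂ ≤ D`,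
`ν, ν₂ < Rp`, `Rc < Rp` and `Rc < D + 𝗁`.  Then every centre within `Rc` of `c` lies in the lattice
`AddSubgroup.closure F`. [folklore] -/
theorem mem_closure_of_norm_sub_le
    (hsep : ∀ x ∈ V, ∀ y ∈ V, x = y ∨ dist x y = 2 ∨ 2 * hales_h0 ≤ dist x y)
    (hF : IsArrangedIn F fccKissingPattern) (h0V : (0 : EuclideanSpace ℝ (Fin 3)) ∈ V)
    (h0 : kissingShell V 0 = F) (hc : ‖c‖ ≤ Real.sqrt 2) (hRp : 4 ≤ Rp) (hD : 19 / 10 ≤ D)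
    (hpat : ∀ y ∈ V, ‖y - c‖ < Rp →
      IsArrangedIn (kissingShell V y) fccKissingPattern ∨ IsArrangedIn (kissingShell V y) hcpKissingPattern)
    (hnohcp : ∀ y ∈ V, ‖y - c‖ < Rp → ∀ B : EuclideanSpace ℝ (Fin 3) →ₗᵢ[ℝ] EuclideanSpace ℝ (Fin 3),
      kissingShell V y = Set.range (fun i => B (hcpRef i)) →
      D < |⟪c - y, B ((Real.sqrt 3)⁻¹ • intVec ![1, 1, 1])⟫|)
    {Rc ν ν₂ : ℝ} (hν4 : 4 ≤ ν ^ 2) (hν : Rc ^ 2 - 2 * Real.sqrt 2 * Rc + 4 ≤ ν ^ 2) (hν0 : 0 ≤ ν)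
    (hν₂4 : 4 ≤ ν₂ ^ 2) (hν₂ : ν ^ 2 - 2 * Real.sqrt 2 * ν + 4 ≤ ν₂ ^ 2) (hν₂0 : 0 ≤ ν₂) (hν₂D : ν₂ ≤ D)
    (hνR : ν < Rp) (hν₂R : ν₂ < Rp) (hRcR : Rc < Rp) (hmargin : Rc < D + layerSpacing) :
    ∀ x ∈ V, ‖x - c‖ ≤ Rc → x ∈ (AddSubgroup.closure F : AddSubgroup (EuclideanSpace ℝ (Fin 3))) := by
  intro x hxV hxRc
  have subF : F ⊆ (AddSubgroup.closure F : AddSubgroup (EuclideanSpace ℝ (Fin 3))) := AddSubgroup.subset_closure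
  have hxR : ‖x - c‖ < Rp := lt_of_le_of_lt hxRc hRcR
  -- first step `x₁ = x + p`
  obtain ⟨p, hp, hle⟩ := exists_mem_kissingShell_norm_add_sub_sq_le (hpat x hxV hxR) c
  have hx₁V : x + p ∈ V := hp.1
  have hp2 : ‖p‖ = 2 := hp.2
  have hx₁ν : ‖x + p - c‖ ≤ ν := by
    have h1 : ‖x + p - c‖ ^ 2 ≤ ν ^ 2 := hle.trans (step_bound_le hν4 hν (norm_nonneg _) hxRc)
    exact (abs_le_of_sq_le_sq' h1 hν0).2
  have hx₁R : ‖x + p - c‖ < Rp := lt_of_le_of_lt hx₁ν hνR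
  -- second step `x₂ = x₁ + p₁`, certified
  obtain ⟨p₁, hp₁, hle₁⟩ := exists_mem_kissingShell_norm_add_sub_sq_le (hpat (x + p) hx₁V hx₁R) c
  have hx₂V : x + p + p₁ ∈ V := hp₁.1
  have hp₁2 : ‖p₁‖ = 2 := hp₁.2
  have hx₂ν : ‖x + p + p₁ - c‖ ≤ ν₂ := by
    have h1 : ‖x + p + p₁ - c‖ ^ 2 ≤ ν₂ ^ 2 := hle₁.trans (step_bound_le hν₂4 hν₂ (norm_nonneg _) hx₁ν)
    exact (abs_le_of_sq_le_sq' h1 hν₂0).2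
  obtain ⟨hx₂L, hx₂S⟩ := chain_certified hsep hF h0V h0 hc hRp hD hpat hnohcp hν₂D hν₂R (x + p + p₁) hx₂V hx₂ν
  -- back to `x₁`: `−p₁ ∈ F`
  have hnegp₁ : -p₁ ∈ kissingShell V (x + p + p₁) := ⟨by simpa using hx₁V, by rw [norm_neg, hp₁2]⟩
  have hp₁F : -p₁ ∈ F := hx₂S ▸ hnegp₁
  have hx₁e : x + p = (x + p + p₁) + -p₁ := by abel
  have hx₁L : x + p ∈ (AddSubgroup.closure F : AddSubgroup (EuclideanSpace ℝ (Fin 3))) := by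
    rw [hx₁e]; exact AddSubgroup.add_mem _ hx₂L (subF hp₁F)
  -- back to `x`: `−p` in the shell of `x₁`
  have hnegp : -p ∈ kissingShell V (x + p) := ⟨by simpa using hxV, by rw [norm_neg, hp2]⟩
  have hxe : x = (x + p) + -p := by abel
  suffices hpF : -p ∈ F by rw [hxe]; exact AddSubgroup.add_mem _ hx₁L (subF hpF)
  rcases hpat (x + p) hx₁V hx₁R with hf | hh
  · -- `x₁` FCC: one FCC step from `x₂`
    have hS₁ := kissingShell_add_eq_of_fcc hF hx₂V hx₂S hp₁F (by rw [← hx₁e]; exact hf)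
    rw [← hx₁e] at hS₁
    exact hS₁ ▸ hnegp
  · -- `x₁` HCP: the far triple of `x₁` is a full layer beyond a far mirror plane
    obtain ⟨B, hB, hlev, hfar⟩ := far_triple_of_hcp (V := V) hF hx₂V hx₂S hp₁F (by rw [← hx₁e]; exact hh)
    rw [← hx₁e] at hB hfar
    rcases hfar (-p) hnegp with h1 | h1
    · exact h1
    · exfalso
      set n := B ((Real.sqrt 3)⁻¹ • intVec ![1, 1, 1]) with hn
      have hn1 : ‖n‖ = 1 := by rw [hn, B.norm_map, norm_nzero]
      have hfarD := hnohcp (x + p) hx₁V hx₁R B hB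
      rw [neg_neg] at hlev
      -- `⟪c − x₁, n⟫ > −D`, hence `> D`
      have e1 : ⟪c - (x + p), n⟫ = ⟪c - (x + p + p₁), n⟫ + layerSpacing := by
        rw [show c - (x + p) = (c - (x + p + p₁)) + p₁ by abel, inner_add_left, hlev]
      have hlow : -ν₂ ≤ ⟪c - (x + p + p₁), n⟫ := by
        have h2 := abs_real_inner_le_norm (c - (x + p + p₁)) n
        rw [hn1, mul_one, norm_sub_rev] at h2
        have h3 := neg_abs_le ⟪c - (x + p + p₁), n⟫
        linarith
      have hpos : D < ⟪c - (x + p), n⟫ := by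
        have : ¬ ⟪c - (x + p), n⟫ < -D := by
          intro hlt; rw [e1] at hlt; linarith [layerSpacing_pos]
        rcases lt_or_ge ⟪c - (x + p), n⟫ 0 with hneg | hnn
        · rw [abs_of_neg hneg] at hfarD; exact absurd (by linarith) this
        · rwa [abs_of_nonneg hnn] at hfarD
      -- `⟪c − x, n⟫ > D + 𝗁 > Rc ≥ ‖c − x‖`
      have e2 : ⟪c - x, n⟫ = ⟪c - (x + p), n⟫ + layerSpacing := by
        conv_lhs => rw [hxe]
        rw [show c - (x + p + -p) = (c - (x + p)) - -p by abel, inner_sub_left, h1]; ring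
      have hbd : ⟪c - x, n⟫ ≤ Rc := by
        have h2 := abs_real_inner_le_norm (c - x) n
        rw [hn1, mul_one, norm_sub_rev] at h2
        linarith [le_abs_self ⟪c - x, n⟫]
      linarith

end Chain

/-! ### The FCC case of the finite-ball statement -/

/-- The radii of the FCC case: with `ν = R − 1`, `ν₂ = √(ν² − 2√2 ν + 4)`, all the hypotheses of
`mem_closure_of_norm_sub_le` hold for `R ≥ 4` (`Rp = 2R − 2`, `D = R − 3/2`, `Rc = R`). [folklore] -/
theorem caseF_radii {R : ℝ} (hR : 4 ≤ R) :
    4 ≤ (R - 1) ^ 2 ∧ R ^ 2 - 2 * Real.sqrt 2 * R + 4 ≤ (R - 1) ^ 2 ∧ 0 ≤ R - 1 ∧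
    4 ≤ Real.sqrt ((R - 1) ^ 2 - 2 * Real.sqrt 2 * (R - 1) + 4) ^ 2 ∧
    (R - 1) ^ 2 - 2 * Real.sqrt 2 * (R - 1) + 4 ≤ Real.sqrt ((R - 1) ^ 2 - 2 * Real.sqrt 2 * (R - 1) + 4) ^ 2 ∧
    0 ≤ Real.sqrt ((R - 1) ^ 2 - 2 * Real.sqrt 2 * (R - 1) + 4) ∧
    Real.sqrt ((R - 1) ^ 2 - 2 * Real.sqrt 2 * (R - 1) + 4) ≤ R - 3 / 2 ∧
    R - 1 < 2 * R - 2 ∧ Real.sqrt ((R - 1) ^ 2 - 2 * Real.sqrt 2 * (R - 1) + 4) < 2 * R - 2 ∧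
    R < 2 * R - 2 ∧ R < (R - 3 / 2) + layerSpacing := by
  have h2 : Real.sqrt 2 ^ 2 = 2 := Real.sq_sqrt (by norm_num)
  have hs2 : Real.sqrt 2 < 1.415 := by
    rw [show (1.415 : ℝ) = Real.sqrt (1.415 ^ 2) by rw [Real.sqrt_sq (by norm_num)]]
    exact Real.sqrt_lt_sqrt (by norm_num) (by norm_num)
  have hs2' : (1.41 : ℝ) < Real.sqrt 2 := by
    rw [show (1.41 : ℝ) = Real.sqrt (1.41 ^ 2) by rw [Real.sqrt_sq (by norm_num)]]
    exact Real.sqrt_lt_sqrt (by norm_num) (by norm_num)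
  have hl : (1.63 : ℝ) < layerSpacing := by linarith [layerSpacing_bounds.1]
  set w := (R - 1) ^ 2 - 2 * Real.sqrt 2 * (R - 1) + 4 with hw
  have hw' : w = (R - 1 - Real.sqrt 2) ^ 2 + 2 := by rw [hw]; nlinarith
  have hw0 : 0 ≤ w := by rw [hw']; positivity
  have hsq : Real.sqrt w ^ 2 = w := Real.sq_sqrt hw0
  have hw4 : 4 ≤ w := by
    rw [hw']
    have : Real.sqrt 2 ≤ R - 1 - Real.sqrt 2 := by linarith
    nlinarith [Real.sqrt_nonneg 2]
  have hwD : w ≤ (R - 3 / 2) ^ 2 := by rw [hw]; nlinarith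
  have hD0 : 0 ≤ R - 3 / 2 := by linarith
  refine ⟨by nlinarith, by nlinarith, by linarith, by rw [hsq]; exact hw4, by rw [hsq], Real.sqrt_nonneg _, ?_,
    by linarith, ?_, by linarith, by linarith⟩
  · calc Real.sqrt w ≤ Real.sqrt ((R - 3 / 2) ^ 2) := Real.sqrt_le_sqrt hwD
      _ = R - 3 / 2 := Real.sqrt_sq hD0
  · calc Real.sqrt w ≤ Real.sqrt ((R - 3 / 2) ^ 2) := Real.sqrt_le_sqrt hwD
      _ = R - 3 / 2 := Real.sqrt_sq hD0
      _ < 2 * R - 2 := by linarith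

/-- **The FCC case of the finite-ball statement.**  `V` a packing of unit balls with Hales's
separation property; `R ≥ 4`; every centre within `2R − 2` of `u` has an FCC- or HCP-arranged
shell; no HCP shell of such a centre has its mirror plane within `R − 3/2` of `u`
(`R − 3/2 < |⟪u − v, B n₀⟫|` for every presentation `B`); and a centre `q` within `√2` of `u`.
Then the centres within `R` of `u` lie in a moved Barlow stacking of a constant Hägg sequence.
[folklore] -/
theorem caseF_ball {V : Set (EuclideanSpace ℝ (Fin 3))} (hV : IsUnitBallPacking V)
    (hsep : ∀ x ∈ V, ∀ y ∈ V, x = y ∨ dist x y = 2 ∨ 2 * hales_h0 ≤ dist x y)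
    {u : EuclideanSpace ℝ (Fin 3)} {R : ℝ} (hR : 4 ≤ R)
    (hpat : ∀ v ∈ V, dist u v < 2 * R - 2 →
      IsArrangedIn (kissingShell V v) fccKissingPattern ∨ IsArrangedIn (kissingShell V v) hcpKissingPattern)
    (hnoQ : ∀ v ∈ V, dist u v < 2 * R - 2 → ∀ B : EuclideanSpace ℝ (Fin 3) →ₗᵢ[ℝ] EuclideanSpace ℝ (Fin 3),
      kissingShell V v = Set.range (fun i => B (hcpRef i)) →
      R - 3 / 2 < |⟪u - v, B ((Real.sqrt 3)⁻¹ • intVec ![1, 1, 1])⟫|)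
    {q : EuclideanSpace ℝ (Fin 3)} (hq : q ∈ V) (hqu : dist u q ≤ Real.sqrt 2) :
    ∃ s : ℤ → ℤ, IsHaggSeq s ∧ ∃ g : EuclideanSpace ℝ (Fin 3) ≃ᵢ EuclideanSpace ℝ (Fin 3),
      ∀ v ∈ V, dist u v ≤ R → v ∈ g '' barlowStacking 2 (2 * Real.sqrt (2 / 3)) s := by
  obtain ⟨hν4, hν, hν0, hν₂4, hν₂, hν₂0, hν₂D, hνR, hν₂R, hRcR, hmargin⟩ := caseF_radii hR
  have hs2 : Real.sqrt 2 < 1.415 := by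
    rw [show (1.415 : ℝ) = Real.sqrt (1.415 ^ 2) by rw [Real.sqrt_sq (by norm_num)]]
    exact Real.sqrt_lt_sqrt (by norm_num) (by norm_num)
  -- `q` is an FCC centre
  have hqR : dist u q < 2 * R - 2 := by linarith
  have hqfcc : IsArrangedIn (kissingShell V q) fccKissingPattern := by
    rcases hpat q hq hqR with h | h
    · exact h
    · exfalso
      obtain ⟨B, hB⟩ := isArrangedIn_hcp_iff_range.1 h
      have h1 := hnoQ q hq hqR B hB
      have h2 : |⟪u - q, B ((Real.sqrt 3)⁻¹ • intVec ![1, 1, 1])⟫| ≤ ‖u - q‖ := by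
        have := abs_real_inner_le_norm (u - q) (B ((Real.sqrt 3)⁻¹ • intVec ![1, 1, 1]))
        rwa [B.norm_map, norm_nzero, mul_one] at this
      rw [← dist_eq_norm] at h2
      linarith
  -- the frame at `q`
  obtain ⟨L, σr, hσr, hS0⟩ := exists_frame_of_fcc_centre hV hqfcc
  obtain ⟨σ, rfl⟩ : ∃ σ : ℤ, (σ : ℝ) = σr := by
    rcases hσr with rfl | rfl
    · exact ⟨1, by norm_num⟩
    · exact ⟨-1, by norm_num⟩
  have hσ : σ = 1 ∨ σ = -1 := by
    rcases hσr with h | h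
    · left; exact_mod_cast h
    · right; exact_mod_cast h
  set V' : Set (EuclideanSpace ℝ (Fin 3)) := {x | q + L x ∈ V} with hV'
  set c' : EuclideanSpace ℝ (Fin 3) := L.symm (u - q) with hc'
  have hF : IsArrangedIn (layerShell (σ : ℝ) (-(σ : ℝ))) fccKissingPattern := isArrangedIn_layerShell_fcc hσ
  have h0V' : (0 : EuclideanSpace ℝ (Fin 3)) ∈ V' := by simp [hV', hq]
  have hc'n : ‖c'‖ ≤ Real.sqrt 2 := by
    rw [hc', L.symm.norm_map, ← dist_eq_norm]; exact hqu
  -- distances in the frame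
  have hdist : ∀ x : EuclideanSpace ℝ (Fin 3), ‖x - c'‖ = dist u (q + L x) := by
    intro x
    rw [hc', ← L.norm_map, map_sub, LinearIsometryEquiv.apply_symm_apply, dist_eq_norm,
      show L x - (u - q) = (q + L x) - u by abel, norm_sub_rev]
  -- transport of the hypotheses
  have hsep' : ∀ x ∈ V', ∀ y ∈ V', x = y ∨ dist x y = 2 ∨ 2 * hales_h0 ≤ dist x y := by
    intro x hx y hy
    rcases hsep _ hx _ hy with h | h | h
    · exact Or.inl (L.injective (add_left_cancel h))
    · exact Or.inr (Or.inl (by rwa [dist_add_left, L.dist_map] at h))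
    · exact Or.inr (Or.inr (by rwa [dist_add_left, L.dist_map] at h))
  have hpat' : ∀ y ∈ V', ‖y - c'‖ < 2 * R - 2 →
      IsArrangedIn (kissingShell V' y) fccKissingPattern ∨ IsArrangedIn (kissingShell V' y) hcpKissingPattern := by
    intro y hy hyR
    rw [hdist] at hyR
    rw [hV', kissingShell_preimage]
    rcases hpat _ hy hyR with h | h
    · exact Or.inl (h.preimage L)
    · exact Or.inr (h.preimage L)
  have hnohcp' : ∀ y ∈ V', ‖y - c'‖ < 2 * R - 2 →
      ∀ B : EuclideanSpace ℝ (Fin 3) →ₗᵢ[ℝ] EuclideanSpace ℝ (Fin 3),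
      kissingShell V' y = Set.range (fun i => B (hcpRef i)) →
      R - 3 / 2 < |⟪c' - y, B ((Real.sqrt 3)⁻¹ • intVec ![1, 1, 1])⟫| := by
    intro y hy hyR B hB
    rw [hdist] at hyR
    have hB' : kissingShell V (q + L y) = Set.range (fun i => (L.toLinearIsometry.comp B) (hcpRef i)) := by
      have e : kissingShell V' y = L ⁻¹' kissingShell V (q + L y) := by rw [hV', kissingShell_preimage]
      ext z
      constructor
      · intro hz
        have : L.symm z ∈ kissingShell V' y := by rw [e]; simpa using hz
        rw [hB] at this
        obtain ⟨i, hi⟩ := this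
        refine ⟨i, ?_⟩
        dsimp only at hi ⊢
        simp only [LinearIsometry.coe_comp, Function.comp_apply, LinearIsometryEquiv.coe_toLinearIsometry]
        rw [hi, LinearIsometryEquiv.apply_symm_apply]
      · rintro ⟨i, rfl⟩
        have : B (hcpRef i) ∈ kissingShell V' y := by rw [hB]; exact ⟨i, rfl⟩
        rw [e] at this
        simpa only [Set.mem_preimage, LinearIsometry.coe_comp, Function.comp_apply,
          LinearIsometryEquiv.coe_toLinearIsometry] using this
    have key := hnoQ _ hy hyR (L.toLinearIsometry.comp B) hB'
    have e2 : ⟪u - (q + L y), (L.toLinearIsometry.comp B) ((Real.sqrt 3)⁻¹ • intVec ![1, 1, 1])⟫ =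
        ⟪c' - y, B ((Real.sqrt 3)⁻¹ • intVec ![1, 1, 1])⟫ := by
      have e3 : u - (q + L y) = L (c' - y) := by
        rw [map_sub, hc', LinearIsometryEquiv.apply_symm_apply]; abel
      simp only [LinearIsometry.coe_comp, Function.comp_apply, LinearIsometryEquiv.coe_toLinearIsometry]
      rw [e3, L.inner_map_map]
    rwa [e2] at key
  -- the chain
  have main := mem_closure_of_norm_sub_le (V := V') (c := c') (Rp := 2 * R - 2) (D := R - 3 / 2) hsep' hF h0V' hS0
    hc'n (by linarith) (by linarith) hpat' hnohcp' hν4 hν hν0 hν₂4 hν₂ hν₂0 hν₂D hνR hν₂R hRcR hmargin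
  refine ⟨fun _ => σ, fun _ => hσ, L.toIsometryEquiv.trans (IsometryEquiv.addLeft q), ?_⟩
  intro v hv hvR
  set x := L.symm (v - q) with hx
  have hxv : q + L x = v := by rw [hx, LinearIsometryEquiv.apply_symm_apply]; abel
  have hxV' : x ∈ V' := by show q + L x ∈ V; rw [hxv]; exact hv
  have hxR : ‖x - c'‖ ≤ R := by rw [hdist, hxv]; exact hvR
  have hxL := main x hxV' hxR
  have hxS : x ∈ barlowStacking 2 layerSpacing (fun _ => σ) := closure_layerShell_subset hxL
  refine ⟨x, ?_, ?_⟩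
  · simpa [layerSpacing] using hxS
  · simp only [IsometryEquiv.trans_apply, IsometryEquiv.addLeft_apply, LinearIsometryEquiv.coe_toIsometryEquiv]
    exact hxv


end Summit.AtomisticToContinuum.Crystallization.Theorems

end
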